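import Summits.BirchSwinnertonDyer.Uniform.UI.O2
import Literature.NumberTheory.EllipticCurves.PAdicHeightsLogProofs
import Literature.NumberTheory.EllipticCurves.PAdicHeightsRegulatorProofs
import Literature.NumberTheory.EllipticCurves.MordellWeilTheoremProofs
import Literature.NumberTheory.EllipticCurves.CanonicalPAdicHeightAdmissibleProofs
import Literature.NumberTheory.EllipticCurves.IwasawaCyclotomicProofs
import Literature.NumberTheory.EllipticCurves.LeadingTerm
import HarnessLib

/-!
# Uniform/UI/O2 — the binder theorem K0: `TateSigmaIrrationalAtThree` ⟹ Schneider's binder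

HONEST FRAMING (cell `bsd-uniform`, seat `ui-o2`): THEOREMS ONLY about the CONJECTURE typed in
`Uniform/UI/O2.lean` (`TateSigmaIrrationalAtThree`, open, nothing asserted); no new definition, no new
named fact, no `sorry`; nothing here proves BSD for any curve, books anything or moves a census mark.
What this file adds to the formulation of record is the kernel-checked IMPLICATION that the seat's
write-up (`HOME/ui/O2-CONJECTURE.md` §3–§4, "prover task K0") stated in prose:

* `eq_one_or_eq_neg_one_of_pow_eq_one_padicThree` — `μ(ℚ₃) = {±1}` (torsion of `ℤ₃ˣ` is
  `μ_{φ(3)} = μ₂`, tree theorem `PadicInt.torsion_units_le_rootsOfUnity`);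
* `exists_ratCast_eq_of_padicLog_eq_padicLog_natCast` — at `p = 3` the kernel of the Iwasawa
  logarithm is RATIONAL: `log₃ b = log₃ d` (`d ≥ 1` an integer, `b ≠ 0`) forces `b = ± d·3ⁿ ∈ ℚ`
  (tree theorems `padicLog_mul_holds`, `padicLog_eq_zero_iff_holds`); this is exactly why the
  conjecture is an IRRATIONALITY statement at `3` (at `p ≥ 5` the Teichmüller units `μ_{p-1} ⊄ ℚ`
  would enter);
* `heightFourOneCoord_ne_zero_of_tateSigmaIrrational` — under the conjecture SW's height (4.1) of
  every admissible point of every curve multiplicative at `3` is non-zero;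
* `pairing_self_ne_zero_of_tateSigmaIrrational` — hence, for THE §4.2 datum (`IsMultCanonical Dh q`),
  `⟨P, P⟩ ≠ 0` for EVERY non-torsion `P ∈ E(ℚ)` (admissible multiples, tree theorem
  `exists_admissible_nsmul_holds`; bilinearity): the height form is ANISOTROPIC on `E(ℚ)/tors`;
* `schneider_of_tateSigmaIrrational_of_rank_one` — hence `Reg₃(E, Dh) ≠ 0` whenever
  `rank_ℤ E(ℚ) = 1` (`Reg = ⟨P₀, P₀⟩` on a Mordell–Weil basis `{P₀}`);
* `regulatorNonvanishingAt_three_of_tateSigmaIrrational` — i.e. the lever's per-pair input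
  `X11b.ClassClosure.RegulatorNonvanishingAt W 3` for every globally minimal `W` of Mordell–Weil
  rank one that is NON-split multiplicative at `3` (the split conjunct is vacuous there:
  `TateParameterData` carries `split`), uniformly in the conductor;
* `uniformSchneiderOnLeverLocusAtThree_of_tateSigmaIrrational` — **K0**: the conjecture together
  with Gross–Zagier–Kolyvagin (tree named fact `rank_eq_analyticRank_of_analyticRank_le_one`,
  bsd.S17, the only non-elementary input, taken as a hypothesis) implies the CLASS-LEVEL binder
  `UniformSchneiderOnLeverLocusAtThree` (= Schneider 1982 on O2's lever locus), hence — with the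
  published binders of `X11b.ClassClosure.bsdp_of_leverLocus_of_regulatorNonvanishing` — `BSD(E,3)`
  on the whole non-split (ram) locus of pocket O2 (722 of the 1 684 TRUE-OPEN classes of record and
  every conductor beyond the tables). CONDITIONAL on the conjecture; nothing is discharged.

CORRECTION of record (to the prose of `O2.lean`, whose `def`s are unaffected): anisotropy on
`E(ℚ)/tors` gives non-degeneracy in rank ONE (this file) — NOT "in every rank": a `ℚ₃`-valued
symmetric form can be anisotropic on the lattice and degenerate (Gram matrix `((1, α), (α, α²))`,
`α ∈ ℚ₃ ∖ ℚ`). Pocket O2 is `r_an = 1`, so the conversion claim of the write-up stands as stated.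

References: [SteinWuthrich2013] §4.1 (4.1), §4.2; [Schneider1982PadicHeightI] §1; [Iwasawa1972PadicL]
§4.4; [Serre1973] Ch. II §3; [Darmon2004] Thm. 3.22 (GZK); `HOME/ui/O2-CONJECTURE.md` §3–§4.
-/

noncomputable section

open scoped Classical

namespace Summit.BirchSwinnertonDyer.Uniform.UI.O2

open WeierstrassCurve Literature.NumberTheory.EllipticCurves
open Literature.NumberTheory.EllipticCurves.SteinWuthrich2013
open Literature.NumberTheory.EllipticCurves.Rank1Residual
open Summit.BirchSwinnertonDyer.Rank1Residual
open Summit.BirchSwinnertonDyer.Rank1Residual.X11b.ClassClosure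

/-! ### `μ(ℚ₃) = {±1}` and the rational kernel of `log₃` -/

/-- **The roots of unity of `ℚ₃` are `±1`**: `w ^ k = 1` with `0 < k` forces `w = 1 ∨ w = -1`
(`‖w‖ = 1`, so `w ∈ ℤ₃ˣ` is torsion, and the torsion of `ℤ₃ˣ` is `μ_{φ(3)} = μ₂` — tree theorem
`PadicInt.torsion_units_le_rootsOfUnity`; Serre, *Cours d'arithmétique* II §3).
[cite: Serre1973, Ch. II §3.1 Prop. 7, §3.2 Prop. 8] -/
theorem eq_one_or_eq_neg_one_of_pow_eq_one_padicThree {w : ℚ_[3]} {k : ℕ} (hk : 0 < k)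
    (hw : w ^ k = 1) : w = 1 ∨ w = -1 := by
  have hnorm : ‖w‖ = 1 := by
    have h1 : ‖w‖ ^ k = 1 := by rw [← norm_pow, hw, norm_one]
    exact (pow_eq_one_iff_of_nonneg (norm_nonneg w) hk.ne').mp h1
  set z : ℤ_[3] := ⟨w, hnorm.le⟩ with hz_def
  have hzw : (z : ℚ_[3]) = w := rfl
  have hzunit : IsUnit z := PadicInt.isUnit_iff.mpr (by simpa [hz_def] using hnorm)
  obtain ⟨u, hu⟩ := hzunit
  have hzk : z ^ k = 1 := by
    apply PadicInt.ext
    push_cast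
    rw [hzw, hw]
  have hupow : u ^ k = 1 := by
    apply Units.ext
    rw [Units.val_pow_eq_pow_val, Units.val_one, hu, hzk]
  have htors : u ∈ CommGroup.torsion ℤ_[3]ˣ := by
    rw [CommGroup.mem_torsion]
    exact isOfFinOrder_iff_pow_eq_one.mpr ⟨k, hk, hupow⟩
  have hroot := PadicInt.torsion_units_le_rootsOfUnity htors
  rw [mem_rootsOfUnity] at hroot
  have htwo : Literature.NumberTheory.EllipticCurves.torsionOrder 3 = 2 := by
    rw [Literature.NumberTheory.EllipticCurves.torsionOrder, cyclotomicExponent,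
      if_neg (by norm_num), pow_one, Nat.totient_prime Nat.prime_three]
  rw [htwo] at hroot
  have hsq : (u : ℤ_[3]) ^ 2 = 1 := by
    rw [← Units.val_pow_eq_pow_val, hroot, Units.val_one]
  have hwsq : w ^ 2 = 1 := by
    have h2 := congrArg (fun t : ℤ_[3] ↦ (t : ℚ_[3])) hsq
    simp only [PadicInt.coe_pow, PadicInt.coe_one] at h2
    rw [hu, hzw] at h2
    exact h2
  exact sq_eq_one_iff.mp hwsq

/-- `log₃ 1 = 0` (from the homomorphism property `padicLog_mul_holds`). [folklore] -/
theorem padicLog_three_one : padicLog 3 (1 : ℚ_[3]) = 0 := by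
  have h := padicLog_mul_holds 3 (x := (1 : ℚ_[3])) (y := 1) one_ne_zero one_ne_zero
  rw [mul_one] at h
  linear_combination -h

/-- **The kernel of `log₃` is rational.** If `b ∈ ℚ₃`, `b ≠ 0`, and `log₃ b = log₃ d` for a
natural number `d ≠ 0`, then `b` is a rational number: `log₃ (b/d) = 0`, so `b/d ∈ 3^ℤ · μ(ℚ₃)`
(tree theorem `padicLog_eq_zero_iff_holds`, Iwasawa 1972 §4.4) `= ± 3^ℤ ⊂ ℚ`
(`eq_one_or_eq_neg_one_of_pow_eq_one_padicThree`). [cite: Iwasawa1972PadicL, §4.4] -/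
theorem exists_ratCast_eq_of_padicLog_eq_padicLog_natCast {b : ℚ_[3]} (hb : b ≠ 0) {d : ℕ}
    (hd : d ≠ 0) (hlog : padicLog 3 b = padicLog 3 ((d : ℚ) : ℚ_[3])) :
    ∃ r : ℚ, b = (r : ℚ_[3]) := by
  have hd3 : ((d : ℚ) : ℚ_[3]) ≠ 0 := by exact_mod_cast hd
  set c : ℚ_[3] := b * ((d : ℚ) : ℚ_[3])⁻¹ with hc_def
  have hc0 : c ≠ 0 := mul_ne_zero hb (inv_ne_zero hd3)
  -- `log₃ d⁻¹ = - log₃ d`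
  have hinv : padicLog 3 (((d : ℚ) : ℚ_[3])⁻¹) = -padicLog 3 ((d : ℚ) : ℚ_[3]) := by
    have h := padicLog_mul_holds 3 (x := ((d : ℚ) : ℚ_[3])) (y := ((d : ℚ) : ℚ_[3])⁻¹) hd3
      (inv_ne_zero hd3)
    rw [mul_inv_cancel₀ hd3, padicLog_three_one] at h
    linear_combination -h
  have hlogc : padicLog 3 c = 0 := by
    rw [hc_def, padicLog_mul_holds 3 hb (inv_ne_zero hd3), hinv, hlog, add_neg_cancel]
  obtain ⟨n, k, hk, hpow⟩ := (padicLog_eq_zero_iff_holds 3 hc0).mp hlogc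
  -- `w := c · 3^{-n}` is a root of unity, hence `± 1`
  have hw := eq_one_or_eq_neg_one_of_pow_eq_one_padicThree hk hpow
  have h3 : ((3 : ℕ) : ℚ_[3]) ≠ 0 := by exact_mod_cast (by norm_num : (3 : ℕ) ≠ 0)
  have hc_eq : c = (c * ((3 : ℕ) : ℚ_[3]) ^ (-n)) * ((3 : ℕ) : ℚ_[3]) ^ n := by
    rw [mul_assoc, ← zpow_add₀ h3, neg_add_cancel, zpow_zero, mul_one]
  have hb_eq : b = c * ((d : ℚ) : ℚ_[3]) := by
    rw [hc_def, mul_assoc, inv_mul_cancel₀ hd3, mul_one]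
  rcases hw with h1 | h1
  · refine ⟨(3 : ℚ) ^ n * d, ?_⟩
    rw [hb_eq, hc_eq, h1, one_mul]
    push_cast
    ring
  · refine ⟨-(3 : ℚ) ^ n * d, ?_⟩
    rw [hb_eq, hc_eq, h1]
    push_cast
    ring

/-! ### Under the conjecture: SW's height (4.1) is anisotropic -/

/-- **Point level.** Under `TateSigmaIrrationalAtThree`: for `W` globally minimal with multiplicative
reduction at `3`, the Tate parameter `q` (`q ≠ 0`, `‖q‖ < 1`, `j(q) = j(E)`) and an admissible point
`P = (x, y)`, SW's height `(4.1) = log₃(den x) - log₃ Σ²_E(P)` is non-zero — else `Σ²_E(P)` would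
lie in the rational kernel coset of `log₃` (`exists_ratCast_eq_of_padicLog_eq_padicLog_natCast`).
[cite: SteinWuthrich2013, §4.1 eq. (4.1), §4.2] -/
theorem heightFourOneCoord_ne_zero_of_tateSigmaIrrational (h : TateSigmaIrrationalAtThree)
    (W : WeierstrassCurve ℚ) [W.IsElliptic] [W.IsGloballyMinimal] (hmult : Mult W 3)
    {q : ℚ_[3]} (hq0 : q ≠ 0) (hq1 : ‖q‖ < 1) (hj : tateJ q = (W.j : ℚ_[3]))
    {x y : ℚ} (hns : W.toAffine.Nonsingular x y) (hadm : W.IsAdmissible 3 (.some x y hns)) :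
    heightFourOneCoord W 3 q x y ≠ 0 := by
  have hirr : ∀ r : ℚ, tateSigmaValueSq W 3 q x y ≠ (r : ℚ_[3]) := by
    have h' := h
    unfold TateSigmaIrrationalAtThree at h'
    exact h' W hmult q hq0 hq1 hj x y hns hadm
  rw [heightFourOneCoord_eq]
  intro hzero
  have hb : tateSigmaValueSq W 3 q x y ≠ 0 := by
    intro h0
    exact hirr 0 (by rw [h0, Rat.cast_zero])
  have hlog : padicLog 3 (tateSigmaValueSq W 3 q x y) = padicLog 3 ((x.den : ℚ) : ℚ_[3]) :=
    (sub_eq_zero.mp hzero).symm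
  obtain ⟨r, hr⟩ := exists_ratCast_eq_of_padicLog_eq_padicLog_natCast hb x.den_nz hlog
  exact hirr r hr

/-- **Admissible points.** Under the conjecture, for THE §4.2 datum `Dh` at a multiplicative `3`
(`IsMultCanonical Dh q`) every admissible point has `⟨P, P⟩ ≠ 0`. [cite: SteinWuthrich2013, §4.2] -/
theorem pairing_self_ne_zero_of_admissible_of_tateSigmaIrrational (h : TateSigmaIrrationalAtThree)
    (W : WeierstrassCurve ℚ) [W.IsElliptic] [W.IsGloballyMinimal] (hmult : Mult W 3)
    {q : ℚ_[3]} (hq0 : q ≠ 0) (hq1 : ‖q‖ < 1) (hj : tateJ q = (W.j : ℚ_[3]))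
    {Dh : PAdicHeightData W 3} (hDh : IsMultCanonical Dh q)
    {P : W.toAffine.Point} (hadm : W.IsAdmissible 3 P) : Dh.pairing P P ≠ 0 := by
  rw [hDh P hadm]
  cases P with
  | zero => exact absurd IsOfFinAddOrder.zero hadm.1
  | some x y hns =>
    exact heightFourOneCoord_ne_zero_of_tateSigmaIrrational h W hmult hq0 hq1 hj hns hadm

/-- **Anisotropy on `E(ℚ)/tors`.** Under the conjecture, for THE §4.2 datum `Dh` at a multiplicative
`3`, `⟨P, P⟩ ≠ 0` for EVERY non-torsion `P ∈ E(ℚ)`: some multiple `mP` (`m ≥ 1`) is admissible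
(tree theorem `exists_admissible_nsmul_holds`) and `⟨mP, mP⟩ = m² ⟨P, P⟩`.
[cite: SteinWuthrich2013, §4.2] [cite: MazurSteinTate2006, §1] -/
theorem pairing_self_ne_zero_of_tateSigmaIrrational (h : TateSigmaIrrationalAtThree)
    (W : WeierstrassCurve ℚ) [W.IsElliptic] [W.IsGloballyMinimal] (hmult : Mult W 3)
    {q : ℚ_[3]} (hq0 : q ≠ 0) (hq1 : ‖q‖ < 1) (hj : tateJ q = (W.j : ℚ_[3]))
    {Dh : PAdicHeightData W 3} (hDh : IsMultCanonical Dh q)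
    {P : W.toAffine.Point} (hP : ¬ IsOfFinAddOrder P) : Dh.pairing P P ≠ 0 := by
  obtain ⟨m, hm0, hadm⟩ := exists_admissible_nsmul_holds W 3 P hP
  have hmP := pairing_self_ne_zero_of_admissible_of_tateSigmaIrrational h W hmult hq0 hq1 hj hDh hadm
  intro hzero
  apply hmP
  rw [map_nsmul, map_nsmul, AddMonoidHom.nsmul_apply, hzero, nsmul_zero, nsmul_zero]

/-! ### Rank one: Schneider's non-degeneracy and the lever's binder -/

/-- **Rank one.** Under the conjecture, if `rank_ℤ E(ℚ) = 1` then `Reg₃(E, Dh) ≠ 0`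
(`SchneiderConjecture Dh`) for THE §4.2 datum at a multiplicative `3`: on a Mordell–Weil basis `{P₀}`
(`exists_isMordellWeilBasis_holds`) `Reg₃ = ⟨P₀, P₀⟩` (`padicRegulatorOf_eq_padicRegulator_holds`), and
`P₀` is non-torsion. [cite: Schneider1982PadicHeightI, §1] [cite: SteinWuthrich2013, §4.2, Conj. 4.1] -/
theorem schneider_of_tateSigmaIrrational_of_rank_one (h : TateSigmaIrrationalAtThree)
    (W : WeierstrassCurve ℚ) [W.IsElliptic] [W.IsGloballyMinimal] (hmult : Mult W 3)
    (hr : W.mordellWeilRank = 1)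
    {q : ℚ_[3]} (hq0 : q ≠ 0) (hq1 : ‖q‖ < 1) (hj : tateJ q = (W.j : ℚ_[3]))
    {Dh : PAdicHeightData W 3} (hDh : IsMultCanonical Dh q) : SchneiderConjecture Dh := by
  -- adapted from `Wuthrich2014.exists_rat_leadingTerms_of_analyticRank_eq_one_odd` (rank-one Gram
  -- determinant)
  obtain ⟨B, hB⟩ := W.exists_isMordellWeilBasis_holds
  have hcard : Fintype.card (Fin W.mordellWeilRank) = 1 := by rw [Fintype.card_fin, hr]
  let k : Fin W.mordellWeilRank := ⟨0, by omega⟩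
  have hRegp : padicRegulator Dh = Dh.pairing (B k) (B k) := by
    rw [← padicRegulatorOf_eq_padicRegulator_holds Dh hB, padicRegulatorOf]
    convert Matrix.det_eq_elem_of_card_eq_one (A := Dh.pairingMatrix B) hcard k
    rfl
  have hBk : ¬ IsOfFinAddOrder (B k) := by
    intro htor
    apply hB.1.ne_zero k
    -- `mordellWeilModTorsion` is elaborated with the classical `DecidableEq ℚ` (tree convention)
    letI : DecidableEq ℚ := fun a b ↦ Classical.propDecidable (a = b)
    simp only [Function.comp_apply]
    exact (QuotientAddGroup.eq_zero_iff _).mpr ((AddCommGroup.mem_torsion _).mpr (by convert htor))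
  unfold SchneiderConjecture
  rw [hRegp]
  exact pairing_self_ne_zero_of_tateSigmaIrrational h W hmult hq0 hq1 hj hDh hBk

/-- **The lever's per-pair input, uniformly.** Under the conjecture: for every globally minimal `W`
of Mordell–Weil rank one that is NON-split multiplicative at `3`, `RegulatorNonvanishingAt W 3`
holds — the non-split conjunct by `schneider_of_tateSigmaIrrational_of_rank_one`, the split conjunct
vacuously (`TateParameterData.split`). No conductor, no certificate. [cite: Schneider1982PadicHeightI, §1]
[cite: SteinWuthrich2013, §4.2, Conj. 4.1] -/
theorem regulatorNonvanishingAt_three_of_tateSigmaIrrational (h : TateSigmaIrrationalAtThree)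
    (W : WeierstrassCurve ℚ) [W.IsElliptic] [W.IsGloballyMinimal] (hmult : Mult W 3)
    (hns : ¬ W.HasSplitMultiplicativeReductionAtPrime 3) (hr : W.mordellWeilRank = 1) :
    RegulatorNonvanishingAt W 3 := by
  refine ⟨fun q Dh hq0 hq1 hj hDh ↦ ?_, fun Dq _ _ ↦ absurd Dq.split hns⟩
  exact schneider_of_tateSigmaIrrational_of_rank_one h W hmult hr hq0 hq1 hj hDh

/-- **K0 (the binder theorem; CONDITIONAL on the conjecture and on GZK).** `TateSigmaIrrationalAtThree`
together with Gross–Zagier–Kolyvagin (`rank_eq_analyticRank_of_analyticRank_le_one`: `r_an ≤ 1 ⟹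
rank_ℤ E(ℚ) = r_an`, tree named fact bsd.S17, hypothesis `hGZK`) implies the CLASS-LEVEL binder
`UniformSchneiderOnLeverLocusAtThree`: on every pair of class X11b at `p = 3` (`r_an = 1`, `Mult 3`,
`Irr 3`) on the lever locus (`Ram 3 ∧ ¬split`), `RegulatorNonvanishingAt W 3`. With the published
facts in the binders of `X11b.ClassClosure.bsdp_of_leverLocus_of_regulatorNonvanishing` this is
`BSD(E,3)` on the whole non-split lever locus of pocket O2, conductor-free — exactly the conversion
the seat's write-up claims for the conjecture (`HOME/ui/O2-CONJECTURE.md` §3). Nothing discharged: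
the conjecture is open. [cite: Darmon2004, Thm. 3.22] [cite: Schneider1982PadicHeightI, §1]
[cite: Skinner2016PacificMC, Thm. A] [cite: Disegni2020, Thm. 1] -/
theorem uniformSchneiderOnLeverLocusAtThree_of_tateSigmaIrrational (h : TateSigmaIrrationalAtThree)
    (hGZK : rank_eq_analyticRank_of_analyticRank_le_one) :
    UniformSchneiderOnLeverLocusAtThree := by
  unfold UniformSchneiderOnLeverLocusAtThree
  intro W _ _ hX hloc
  have han : W.analyticRank = 1 := hX.1
  have hmult : Mult W 3 := hX.2.2.1
  have hr : W.mordellWeilRank = 1 := by rw [(hGZK W han.le).1, han]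
  have hns : ¬ W.HasSplitMultiplicativeReductionAtPrime 3 := fun hsplit ↦ by
    have h5 := hloc.2 hsplit
    omega
  exact regulatorNonvanishingAt_three_of_tateSigmaIrrational h W hmult hns hr

/-- **K0, strong form.** The transcendence form `TateSigmaTranscendentalAtThree` implies the same
class-level binder (via `tateSigmaIrrational_of_transcendental`). [cite: Bertrand1982, Cor. 2, Cor. 4] -/
theorem uniformSchneiderOnLeverLocusAtThree_of_tateSigmaTranscendental
    (h : TateSigmaTranscendentalAtThree) (hGZK : rank_eq_analyticRank_of_analyticRank_le_one) :
    UniformSchneiderOnLeverLocusAtThree :=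
  uniformSchneiderOnLeverLocusAtThree_of_tateSigmaIrrational (tateSigmaIrrational_of_transcendental h)
    hGZK

end Summit.BirchSwinnertonDyer.Uniform.UI.O2

end
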